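import Summits.BirchSwinnertonDyer.BirchSwinnertonDyer.Theses.PrintX8VS
import Summits.BirchSwinnertonDyer.BirchSwinnertonDyer.Theorems.ConjSpanGenAllLevels
import Summits.BirchSwinnertonDyer.BirchSwinnertonDyer.Theorems.PrintX8VSGlue
import Literature.NumberTheory.Automorphic.CongruenceSubgroupPropertySL2AwayHolds
import HarnessLib

/-!
# Route `PrintX8VS`: the crux `ConjSpanGenAll` (stmt-BirchSwinnertonDyer-21705) — THEOREM B — PROVED
# UNCONDITIONALLY, by name; the held input `InputCongruenceAway` (22563) discharged; crux 20622
# `MuBoundSmallImageX8` of route `PrintX8` from the held Coleman–Kato/period item 20771 ALONE; and the X8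
# leaf from K1 + held/published items with NO group-theoretic input (cell `bsd-print-x8`, seat p3 gen 4)

WHAT. THEOREM B (bsd-f3-mu-an g4/g5, MEMO-an §13.2): for every `N ≥ 1` and every prime `p ∤ N`,
`Γ_H(N) = {γ ∈ Γ₀(N) : d(γ) ≡ ±pᵏ (mod N)}` lies in `⟨elements with |d| = pᵐ, torsion, trace ±2⟩ ·
[Γ₀(N), Γ₀(N)]` (`Rank1Residual.ConjSpanGen N p`; equivalently, Manin 1972 Prop. 1.4, the closed `p`-power
cyclotomic winding classes `{0 → a/pⁿ}` span `pr Γ_H(N) ⊆ H₁(X₀(N); ℤ)`). Its kernel proof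
(`Theorems/ConjSpanGenAllLevels*.lean`, landed by p4 g2 as p569503/p570691/p571570) reduces it by the orbit
trick in `Γ₀(N; ℤ[1/p])` to Vaserstein's relative theorem (V) `G(e·ℤ[1/m], ℤ[1/m]) ≤ E(e·ℤ[1/m], ℤ[1/m])`
(`conjSpanGenAll_of_vaserstein_away`), and (V) is now a TREE THEOREM with no named-fact input:
`SL2Rel.Away.relG_le_relE_span_natCast` (ty2 g7 p575156 `CongruenceSubgroupPropertySL2AwayHolds.lean`, over
the port A-I–A-V p570731/p571658/p572346/p572949/p573543 of the tree's Vaserstein–Liehl–Bass–Milnor–Serre road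
to `A = ℤ[1/m]` and bsd-f3-mu p1 g0's BMS Thm. 3.6 over `ℤ[1/m]` p574472). This file is the one-line
assembly the gate needs from a PROVER seat (D-0016):

* `conjSpanGenAll_holds : PrintX8VS.ConjSpanGenAll` — **crux 21705 CLOSED, flag-free** (no (L) Morris, no
  (C) Serre as hypotheses); `conjSpanGen_holds` — THEOREM B at one `(N, p)`.
* `inputCongruenceAway_holds : PrintX8VS.InputCongruenceAway` — the held input 22563 DISCHARGED (= ty2 g7's
  `SerreSL2Congruence1970_congruenceSubgroupProperty_away_holds`, re-exported under `Theorems/` so that the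
  gate's `workitem close --by` accepts it).
* `muBoundSmallImageX8_of_inputSharpFlatMuTransfer : PrintX8.InputSharpFlatMuTransfer → PrintX8.MuBoundSmallImageX8`
  — crux 20622 of route `PrintX8` from the held item 20771 (Sprung 2012's ♯/♭ Coleman–Kato package ∧ the
  period unit at `3`) ALONE: SPAN is now a theorem (`PrintX8VSGlue.muBoundSmallImageX8_of_conjSpanGenAll`).
* `wAllCornerX8_of_K1_of_heldInputs` — **the X8 leaf `WAllCornerX8` from K1 (`SprungLowerDivisibilityAtThree`,
  19875 — the ONE unprinted residual, OPEN IN PRINT at `a₃ = ±3`) and the HELD/PUBLISHED items 20771, 20403,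
  19921 only** — seat p3's strategy sentence in final form: after THEOREM B the exact missing input of leaf X8
  is K1 and nothing else that is not a published named fact.

HONEST FRAMING: the mathematics of THEOREM B is bsd-f3-mu-an's and the Vaserstein port is ty2 g7's / bsd-f3-mu
p1 g0's; this file only composes tree theorems (credit in each docstring). THEOREM B is NOT in print (nearest:
Sun 2007 Conj. 8 / Kim–Sun; Manin 1972; Stevens 1982) — «beyond-print theorem: YES» for `conjSpanGen_holds`
as a kernel statement, by the cell's combined work. No census cell moves (PARTITION currency is the leaf, which
still needs K1); BSD is not proved by any of this.

References: [Vaserstein1972SL2] Theorem (p. 313); [SerreSL2Congruence1970] §2.6 Thm. 2 (b), Cor. 3;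
[BassMilnorSerre1967] Ch. I Thm. 3.6; [Manin1972] Prop. 1.4; [Sprung2012] Def. 6.1, Thm. 7.14, Prop. 7.19;
[Pollack2003] Def. 6.15; [Miller2011LMS] Def. 1.1.
-/

set_option autoImplicit false
-- justification: the mandated namespace `Summit.BirchSwinnertonDyer.BirchSwinnertonDyer.Theorems`
-- (single-conjunct summit, Sub = Summit) repeats a segment by design (D-0017).
set_option linter.dupNamespace false

noncomputable section

namespace Summit.BirchSwinnertonDyer.BirchSwinnertonDyer.Theorems.PrintX8VSConjSpanGenAll

open Literature.NumberTheory.Automorphic Literature.NumberTheory.EllipticCurves.Rank1Residual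
  Summit.BirchSwinnertonDyer.BirchSwinnertonDyer.Theorems
  Summit.BirchSwinnertonDyer.BirchSwinnertonDyer.Theses

/-- **Crux 21705 `PrintX8VS.ConjSpanGenAll` — THEOREM B — PROVED, unconditionally**: for every `N` and every
prime `p ∤ N`, `ConjSpanGen N p`. Proof: `ConjSpanGenAllLevels.conjSpanGenAll_of_vaserstein_away` (the orbit
trick in `Γ₀(N; ℤ[1/p])`, bsd-f3-mu-an g5 / p4 g2) applied to Vaserstein's relative theorem over `ℤ[1/m]`,
`SL2Rel.Away.relG_le_relE_span_natCast` (ty2 g7, input-free). [cite: Vaserstein1972SL2, Theorem (p. 313)]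
[cite: Manin1972, Prop. 1.4] [cite: SerreSL2Congruence1970, §2.6 Thm. 2 (b)] -/
theorem conjSpanGenAll_holds : PrintX8VS.ConjSpanGenAll :=
  ConjSpanGenAllLevels.conjSpanGenAll_of_vaserstein_away SL2Rel.Away.relG_le_relE_span_natCast

/-- **THEOREM B at one level**: for `p` prime and `p ∤ N`, `Γ_H(N) ⊆ ⟨good, torsion, parabolic⟩ · [Γ₀(N), Γ₀(N)]`
(`ConjSpanGen N p`), unconditionally. [cite: Vaserstein1972SL2, Theorem (p. 313)] [cite: Manin1972, Prop. 1.4] -/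
theorem conjSpanGen_holds {N p : ℕ} (hp : p.Prime) (hpN : ¬ p ∣ N) : ConjSpanGen N p :=
  conjSpanGenAll_holds N p hp hpN

/-- **Held input 22563 `PrintX8VS.InputCongruenceAway` DISCHARGED**: Serre's congruence subgroup property for
`SL₂(ℤ[1/m])`, `m ≥ 2` (every finite-index subgroup contains a principal congruence subgroup) is ty2 g7's tree
theorem `SerreSL2Congruence1970_congruenceSubgroupProperty_away_holds` (Vaserstein road over `ℤ[1/m]`),
re-exported here under `Theorems/`. [cite: SerreSL2Congruence1970, §2.6 Thm. 2 (b) and Cor. 3]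
[cite: Vaserstein1972SL2, Theorem (p. 313)] -/
theorem inputCongruenceAway_holds : PrintX8VS.InputCongruenceAway :=
  SerreSL2Congruence1970_congruenceSubgroupProperty_away_holds

/-- **Crux 20622 `MuBoundSmallImageX8` of route `PrintX8` from the held item 20771 ALONE** (Sprung 2012's ♯/♭
Coleman–Kato package ∧ the period unit at `3`): SPAN is a theorem (`conjSpanGenAll_holds`), so p3 g3/p1 g4's
VS road `PrintX8VSGlue.muBoundSmallImageX8_of_conjSpanGenAll` needs no further hypothesis. On every X8 pair
with `ρ̄_{E,3}` not onto and every colour, `μ(X^•(E/ℚ_∞)) ≤ μ(Λ/(ϖ·L^•₃(E)))`.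
[cite: Sprung2012, Def. 6.1, Thm. 7.14 and Prop. 7.19] [cite: Pollack2003, Def. 6.15] -/
theorem muBoundSmallImageX8_of_inputSharpFlatMuTransfer (hIn : PrintX8.InputSharpFlatMuTransfer) :
    PrintX8.MuBoundSmallImageX8 :=
  PrintX8VSGlue.muBoundSmallImageX8_of_conjSpanGenAll conjSpanGenAll_holds hIn

/-- **The X8 leaf from K1 and HELD/PUBLISHED items only** — no group-theoretic, no Galois-image, no
μ-conjecture input: K1 `SprungLowerDivisibilityAtThree` (19875; OPEN IN PRINT at `a₃ = ±3`), the held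
Coleman–Kato/period item 20771, the published bundle 20403 and Gross–Zagier–Kolyvagin 19921 give
`WAllCornerX8` (= `PrintX8VS.closes` with SPAN and every glue/assembly item discharged by tree theorems).
[cite: Miller2011LMS, §1 and Def. 1.1] [cite: Sprung2012, Main Conj. 7.21 (p. 1505)] -/
theorem wAllCornerX8_of_K1_of_heldInputs (hK1 : PrintX8VS.SprungLowerDivisibilityAtThree)
    (hIn : PrintX8VS.InputSharpFlatMuTransfer) (hPub : PrintX8VS.PublishedInputsX8)
    (hGZK : PrintX8VS.RankEqAnalyticRankLeOne) : Summit.BirchSwinnertonDyer.WAllCornerX8 :=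
  PrintX8VSGlue.wAllCornerX8_of_K1_of_conjSpanGenAll hK1 conjSpanGenAll_holds hIn hPub hGZK

end Summit.BirchSwinnertonDyer.BirchSwinnertonDyer.Theorems.PrintX8VSConjSpanGenAll

end
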